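import Summits.Ventures.PercRepro.RankLevelSetCoreSixColoopFreeFlatCap
import Summits.Ventures.PercRepro.TriangleCapEightI

/-!
# PercRepro — THE SMALL-CIRCUIT UNION: `k·r(S) ≤ (k − 1)·|S|` FOR A UNION `S` OF CIRCUITS OF SIZE `≤ k` (p8 g11, S3)

`proofs/SUBCLAIM-S3-p8.md` §3y. Adding a circuit `C` (`|C| = c ≤ k`) to a set `S` with `S ∩ C ⊊ C` (independent, of rank
`i = |S ∩ C|`) raises the rank by at most `c − 1 − i` (submodularity) and the size by `c − i`; as `c ≤ k + i`,
`k·(c − 1 − i) ≤ (k − 1)·(c − i)`, so the invariant `k·r(S) ≤ (k − 1)·|S|` propagates over any finite union of circuits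
of size `≤ k` (`mul_eRk_union_circuit_le`, `mul_eRk_biUnion_circuits_le`). Hence in a COLOOP-FREE matroid of rank `p`
and corank `d` with `(k − 1)·d < p` the union `S` of all circuits of size `≤ k` is not spanning
(`r(S) ≤ (k − 1)·(|S| − r(S)) ≤ (k − 1)·d < p`) and the coloop-free flat cap (RankLevelSetCoreSixColoopFreeFlatCap)
gives `|S| + 1 ≤ r(S) + d`: every circuit of size `≤ k` lies in one set of nullity `≤ d − 1`
(`exists_eRk_eq_of_circuits_le`). At `k = 3` on the `e`-free core this drops p3's triangle table by one nullity:
`s₃ ≤ cq3 (d − 1)` whenever `2d < p` (`ncard_triangles_le_cq3_pred_of_coloopFree`) — `10` in place of `11` at the cell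
`(23, 7)`, `11` / `13` / `16` / `20` in place of `12` / `14` / `17` / `21` at `(23, 8 … 11)`. Axioms: standard.
-/

open scoped Matroid

namespace PercRepro

namespace ThmN

open Set

variable {α : Type}

/-- The rank of any set of a finite matroid is a natural number. -/
theorem exists_eRk_eq_nat (M : Matroid α) [M.Finite] (X : Set α) : ∃ r : ℕ, M.eRk X = r := by
  have hfin : (X ∩ M.E).Finite := M.ground_finite.subset Set.inter_subset_right
  have hlt : M.eRk X < ⊤ := by
    rw [← M.eRk_inter_ground]
    exact (M.eRk_le_encard _).trans_lt hfin.encard_lt_top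
  exact ⟨(M.eRk X).toNat, (ENat.coe_toNat hlt.ne).symm⟩

/-- The monotonicity of p3's triangle table on its tabulated range. -/
theorem cq3_mono_of_le (a b : ℕ) (hab : a ≤ b) (hb : b ≤ 29) : TriangleCap.cq3 a ≤ TriangleCap.cq3 b := by
  have key : ∀ b, b ≤ 29 → ∀ a, a ≤ b → TriangleCap.cq3 a ≤ TriangleCap.cq3 b := by decide
  exact key b hb a hab

/-- **One circuit at a time**: if `k·r(S) ≤ (k − 1)·|S|` and `C` is a circuit with `|C| ≤ k`, then
`k·r(S ∪ C) ≤ (k − 1)·|S ∪ C|`. -/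
theorem mul_eRk_union_circuit_le (M : Matroid α) [M.Finite] {k : ℕ} {S C : Set α} (hS : S ⊆ M.E)
    (hC : M.IsCircuit C) (hCk : C.ncard ≤ k) {r : ℕ} (hr : M.eRk S = r) (hk : k * r ≤ (k - 1) * S.ncard)
    {r' : ℕ} (hr' : M.eRk (S ∪ C) = r') : k * r' ≤ (k - 1) * (S ∪ C).ncard := by
  classical
  have hSfin : S.Finite := M.ground_finite.subset hS
  have hCfin : C.Finite := M.ground_finite.subset hC.subset_ground
  by_cases hCS : C ⊆ S
  · rw [Set.union_eq_self_of_subset_right hCS] at hr' ⊢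
    rw [hr] at hr'
    have hrr : r = r' := by exact_mod_cast hr'
    rw [← hrr]; exact hk
  · have hssub : S ∩ C ⊂ C := ⟨Set.inter_subset_right, fun h => hCS (fun x hx => (h hx).1)⟩
    have hI : M.Indep (S ∩ C) := hC.ssubset_indep hssub
    have hIr : M.eRk (S ∩ C) = ((S ∩ C).ncard : ℕ∞) := by
      rw [hI.eRk_eq_encard, (hSfin.subset Set.inter_subset_left).cast_ncard_eq]
    obtain ⟨rc, hrc⟩ := exists_eRk_eq_nat M C
    have hCr : rc + 1 = C.ncard := by
      have h := hC.eRk_add_one_eq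
      rw [hrc, ← hCfin.cast_ncard_eq] at h
      exact_mod_cast h
    have hilt : (S ∩ C).ncard < C.ncard := Set.ncard_lt_ncard hssub hCfin
    have hsub := M.eRk_inter_add_eRk_union_le S C
    rw [hIr, hr', hr, hrc] at hsub
    have hsubN : (S ∩ C).ncard + r' ≤ r + rc := by exact_mod_cast hsub
    have hu : (S ∪ C).ncard + (S ∩ C).ncard = S.ncard + C.ncard :=
      Set.ncard_union_add_ncard_inter S C hSfin hCfin
    have hk1 : 1 ≤ k := by omega
    obtain ⟨m, rfl⟩ : ∃ m, k = m + 1 := ⟨k - 1, by omega⟩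
    obtain ⟨j, hj⟩ : ∃ j, C.ncard = (S ∩ C).ncard + 1 + j := ⟨C.ncard - (S ∩ C).ncard - 1, by omega⟩
    have hu' : (S ∪ C).ncard = S.ncard + j + 1 := by omega
    have hr'le : r' ≤ r + j := by omega
    have hjm : j ≤ m := by omega
    simp only [Nat.add_sub_cancel] at hk ⊢
    rw [hu']
    nlinarith [Nat.mul_le_mul_left (m + 1) hr'le, hk, hjm]

/-- **The small-circuit union**: for a finset `𝒯` of circuits of size `≤ k`, `k·r(⋃𝒯) ≤ (k − 1)·|⋃𝒯|`. -/
theorem mul_eRk_biUnion_circuits_le (M : Matroid α) [M.Finite] (k : ℕ) (𝒯 : Finset (Set α))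
    (h𝒯 : ∀ C ∈ 𝒯, M.IsCircuit C ∧ C.ncard ≤ k) {r : ℕ} (hr : M.eRk (⋃ C ∈ 𝒯, C) = r) :
    k * r ≤ (k - 1) * (⋃ C ∈ 𝒯, C).ncard := by
  classical
  induction 𝒯 using Finset.induction_on generalizing r with
  | empty =>
    simp only [Finset.notMem_empty, Set.iUnion_of_empty, Set.iUnion_empty] at hr ⊢
    rw [M.eRk_empty] at hr
    have h0 : r = 0 := by exact_mod_cast hr.symm
    simp [h0]
  | insert T 𝒯 _ ih =>
    rw [Finset.set_biUnion_insert, Set.union_comm] at hr ⊢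
    have hS : (⋃ C ∈ 𝒯, C) ⊆ M.E := by
      intro x hx
      simp only [Set.mem_iUnion, exists_prop] at hx
      obtain ⟨C, hC, hxC⟩ := hx
      exact (h𝒯 C (Finset.mem_insert_of_mem hC)).1.subset_ground hxC
    obtain ⟨r₀, hr₀⟩ := exists_eRk_eq_nat M (⋃ C ∈ 𝒯, C)
    have ih' := ih (fun C hC => h𝒯 C (Finset.mem_insert_of_mem hC)) hr₀
    exact mul_eRk_union_circuit_le M hS (h𝒯 T (Finset.mem_insert_self T 𝒯)).1
      (h𝒯 T (Finset.mem_insert_self T 𝒯)).2 hr₀ ih' hr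

/-- **The circuits of size `≤ k` live in a set of nullity `≤ d − 1`** on a coloop-free matroid of rank `p` and
corank `d` with `(k − 1)·d < p`: their union `S` is not spanning, so the coloop-free flat cap gives
`|S| + 1 ≤ r(S) + d`. -/
theorem exists_eRk_eq_of_circuits_le (M : Matroid α) [M.Finite] (hcf : ∀ e ∈ M.E, ¬ M.IsColoop e)
    {p d k : ℕ} (hk1 : 1 ≤ k) (hR : M.eRank = (p : ℕ∞)) (hn : M.E.ncard = p + d) (hpd : (k - 1) * d < p) :
    ∃ r : ℕ, M.eRk (⋃ C ∈ {C : Set α | M.IsCircuit C ∧ C.ncard ≤ k}, C) = r ∧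
      (⋃ C ∈ {C : Set α | M.IsCircuit C ∧ C.ncard ≤ k}, C).ncard + 1 ≤ r + d := by
  classical
  set 𝒮 : Set (Set α) := {C : Set α | M.IsCircuit C ∧ C.ncard ≤ k} with h𝒮
  have h𝒮fin : 𝒮.Finite := M.ground_finite.finite_subsets.subset (fun C hC => hC.1.subset_ground)
  have hUeq : (⋃ C ∈ h𝒮fin.toFinset, C) = ⋃ C ∈ 𝒮, C := by
    ext x
    simp only [Set.mem_iUnion, exists_prop, Set.Finite.mem_toFinset]
  set S := ⋃ C ∈ 𝒮, C with hSdef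
  have hS : S ⊆ M.E := by
    intro x hx
    simp only [hSdef, Set.mem_iUnion, exists_prop] at hx
    obtain ⟨C, hC, hxC⟩ := hx
    exact hC.1.subset_ground hxC
  obtain ⟨r, hr⟩ := exists_eRk_eq_nat M S
  have hkr : k * r ≤ (k - 1) * S.ncard := by
    have := mul_eRk_biUnion_circuits_le M k h𝒮fin.toFinset
      (fun C hC => by rw [Set.Finite.mem_toFinset] at hC; exact hC) (r := r) (by rw [hUeq]; exact hr)
    rwa [hUeq] at this
  have hSn : S.ncard ≤ p + d := by rw [← hn]; exact Set.ncard_le_ncard hS M.ground_finite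
  have hrp : r ≤ p := by
    have := M.eRk_le_eRank S
    rw [hr, hR] at this
    exact_mod_cast this
  have hlt : r < p := by
    rcases Nat.lt_or_ge r p with h | h
    · exact h
    · exfalso
      have hrp' : r = p := le_antisymm hrp h
      rw [hrp'] at hkr
      obtain ⟨m, rfl⟩ : ∃ m, k = m + 1 := ⟨k - 1, by omega⟩
      simp only [Nat.add_sub_cancel] at hkr hpd
      nlinarith [Nat.mul_le_mul_left m hSn]
  exact ⟨r, hr, ncard_add_one_le_eRk_add_of_coloopFree M hcf hR hn hS hr hlt⟩

/-- The `e`-free condition restricts to any subset of the ground set. -/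
theorem free_restrict (M : Matroid α)
    (hfree : ∀ e ∈ M.E, ∃ A ⊆ M.E \ {e}, e ∉ M.closure A ∧ e ∉ M.closure ((M.E \ {e}) \ A))
    {S : Set α} (hS : S ⊆ M.E) :
    ∀ e ∈ (M ↾ S).E, ∃ A ⊆ (M ↾ S).E \ {e}, e ∉ (M ↾ S).closure A ∧
      e ∉ (M ↾ S).closure (((M ↾ S).E \ {e}) \ A) := by
  intro e he
  rw [Matroid.restrict_ground_eq] at he ⊢
  obtain ⟨A₀, hA₀, he1, he2⟩ := hfree e (hS he)
  have hSE : S \ M.E = ∅ := Set.sdiff_eq_empty.2 hS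
  refine ⟨A₀ ∩ S, fun x hx => ⟨hx.2, (hA₀ hx.1).2⟩, ?_, ?_⟩
  · rw [Matroid.restrict_closure_eq', hSE, Set.union_empty]
    intro h
    exact he1 (M.closure_subset_closure (Set.inter_subset_left.trans Set.inter_subset_left) h.1)
  · rw [Matroid.restrict_closure_eq', hSE, Set.union_empty]
    intro h
    apply he2
    refine M.closure_subset_closure ?_ h.1
    intro x hx
    obtain ⟨⟨hxS, hxe⟩, hxA⟩ := hx.1
    exact ⟨⟨hS hxS, hxe⟩, fun hxA₀ => hxA ⟨hxA₀, hxS⟩⟩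

/-- **THE TRIANGLE DROP**: on a coloop-free `e`-free core of rank `p` and corank `d` with `2d < p` (and
`1 ≤ d ≤ 30`), the triangles number at most `cq3 (d − 1)`: they all lie in the union `S` of the circuits of size
`≤ 3`, a set of nullity `≤ d − 1`, and p3's table applies to the restriction `M ↾ S`. -/
theorem ncard_triangles_le_cq3_pred_of_coloopFree (M : Matroid α) [M.Finite]
    (hfree : ∀ e ∈ M.E, ∃ A ⊆ M.E \ {e}, e ∉ M.closure A ∧ e ∉ M.closure ((M.E \ {e}) \ A))
    (hcf : ∀ e ∈ M.E, ¬ M.IsColoop e) {p d : ℕ} (hR : M.eRank = (p : ℕ∞)) (hn : M.E.ncard = p + d)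
    (hpd : 2 * d < p) (hd1 : 1 ≤ d) (hd30 : d ≤ 30) :
    {C : Set α | M.IsCircuit C ∧ C.ncard = 3}.ncard ≤ TriangleCap.cq3 (d - 1) := by
  classical
  obtain ⟨r, hr, hcap⟩ := exists_eRk_eq_of_circuits_le M hcf (k := 3) (by norm_num) hR hn (by simpa using hpd)
  set S := ⋃ C ∈ {C : Set α | M.IsCircuit C ∧ C.ncard ≤ 3}, C with hSdef
  have hS : S ⊆ M.E := by
    intro x hx
    simp only [hSdef, Set.mem_iUnion, exists_prop] at hx
    obtain ⟨C, hC, hxC⟩ := hx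
    exact hC.1.subset_ground hxC
  have hSfin : S.Finite := M.ground_finite.subset hS
  haveI hNfin : (M ↾ S).Finite := ⟨by rw [Matroid.restrict_ground_eq]; exact hSfin⟩
  have hrS : r ≤ S.ncard := by
    have := M.eRk_le_encard S
    rw [hr, ← hSfin.cast_ncard_eq] at this
    exact_mod_cast this
  obtain ⟨ν, hν⟩ : ∃ ν, S.ncard = r + ν := ⟨S.ncard - r, by omega⟩
  have hνd : ν ≤ d - 1 := by omega
  -- the triangles of `M` are the triangles of `M ↾ S`
  have htri : {C : Set α | M.IsCircuit C ∧ C.ncard = 3} = {C : Set α | (M ↾ S).IsCircuit C ∧ C.ncard = 3} := by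
    ext C
    simp only [Set.mem_setOf_eq]
    constructor
    · rintro ⟨hC, h3⟩
      refine ⟨(Matroid.restrict_isCircuit_iff hS).2 ⟨hC, ?_⟩, h3⟩
      intro x hx
      simp only [hSdef, Set.mem_iUnion, exists_prop]
      exact ⟨C, ⟨hC, h3.le⟩, hx⟩
    · rintro ⟨hC, h3⟩
      exact ⟨((Matroid.restrict_isCircuit_iff hS).1 hC).1, h3⟩
  have hdN : (M ↾ S).E.encard = (M ↾ S).eRank + ν := by
    rw [Matroid.restrict_ground_eq, Matroid.eRank_restrict, hr, ← hSfin.cast_ncard_eq, hν]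
    push_cast; rfl
  have h1 := TriangleCap.core_ncard_triangles_le_cq3 (M ↾ S) (free_restrict M hfree hS) hdN
  rw [htri]
  exact h1.trans (cq3_mono_of_le ν (d - 1) hνd (by omega))

end ThmN

end PercRepro
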